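/-
Origin: expansion seat `planner-pub-hodgecm-mc-theta-3-g9-0`, handover #S1 17:39Z md5 8d2d12959517 (337 l.; theta-3-g8 bytes, certified here; NEW additive Model leaf, ns HodgeCM.Model.ThetaSpace; imports Model.ThetaSpace. KTypeSituation.IsSaturated / .IsStrict / thetaSpaceSatOf P ιinf Δ κ₁ τ₁ KΓ 𝓕 := ⨆ over {S // S.IsSaturated KΓ ∧ S.IsStrict} of S.forms 𝓕; thetaSpaceSatOf_le_thetaSpaceOf, _bot, _anti, forms_le_thetaSpaceSatOf, thetaSpaceSatOf_le_iSup_saturated (E5), level engine exists_mem_thetaSpaceSatOf_coe_eq_of_le (h : Δ' ≤ Δ) (hK : KΓ' ≤ KΓ), classSupplyDataOfSub / classSupplyDataSatAt. Header ll.30–32 «UNCHECKED DRAFT» is superseded by this certificate (doc only; bytes kept to spare re-verifiers a delta run).) (`HOME/mc/pub-hodgecm-mc-theta-3-g9/lean/stage/HodgeCM/Model/ThetaSpaceSat.lean`, md5 8d2d1295, 337 lines);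
landed by the gen-13 packager (p-g13) in gate run 37 as `HodgeCM/Model/ThetaSpaceSat.lean` (verbatim).
-/
/-
Origin: expansion seat `planner-pub-hodgecm-mc-theta-3-g8-0` (theta supply / second-lift lane; v2 pin custodian),
2026-08-19 — DRAFT for the (Θ-sat)/(Θ-sat-K) pin packet of BINDER-TRIAGE §56/§57 (RULING (W1): `Level V` = PerL's
pair `(Γ, K_f)`; theta space of record = the `Γ.K`-SATURATED span).  NEW ADDITIVE LEAF over `Model/ThetaSpace.lean`
(82339bb8754e, byte-identical): nothing installed is edited by this file.  Rides RUN 37 WITH the `Level`-pair root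
packet (it does not mention `Level.K` itself — the index `KΓ` is an abstract subgroup of `GU`; the pin
`Model/ThetaSpaceInputPin` sets `KΓ Γ := (Γ.K).map (finToGU h)`).

CONTENT (naming (R1-add) of glue-1-g5 12:32:51Z, ACCEPTED by the pin owner 13:11:45Z):
* `KTypeSituation.IsStrict S` ((SS-K) exit (X1)) — the test families intertwine `σ` with the Weil action ON THE
  NOSE; exports (E1) `IsStrict.act_family`, (E2) `IsStrict.act_family_eq_self` (with saturation), (E3)
  `IsStrict.act_family_arch` (weight matching), (E4) `IsStrict.act_family_arch_mul` ((E2) × (E3)) = the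
  on-the-nose hA/hB of tree
  `UnitaryDualPairSeesawWedgeKType.seesawWedge_mem_weightSpace` for binder-1's `SeesawHyp.wedge_mem`.
* `KTypeSituation.IsSaturated S KΓ` — every element of the compact open `KΓ ≤ G_U(𝔸)` is an index element of the
  situation acting trivially on the weight (`∃ c, S.κ c = k ∧ S.τ c = 1`): the adelic theta forms of `S` are then
  RIGHT-`KΓ`-INVARIANT functions on `G_U(ℚ)\G_U(𝔸)` (PerL l. 520: "a form on `Γ\𝔹²` is a `K_f`-invariant form on
  the adelic quotient", `Γ = G(ℚ) ∩ K_f K_∞`).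
* `thetaSpaceSatOf P ιinf Δ κ₁ τ₁ KΓ 𝓕` — the span of the archimedean restrictions of the theta forms of all
  situations SATURATED at `KΓ`; `thetaSpaceSatOf_le_thetaSpaceOf`, `thetaSpaceSatOf_bot` (saturation at `⊥` is
  no condition: the v2 = unsaturated theta space is the instance `KΓ := ⊥`), antitonicity in `KΓ`
  (`thetaSpaceSatOf_anti`), and the LEVEL-CHANGE ENGINE `exists_mem_thetaSpaceSatOf_coe_eq_of_le (h : Δ' ≤ Δ)
  (hK : KΓ' ≤ KΓ)` replacing `exists_mem_thetaSpaceOf_coe_eq_of_le` in period-1's M6 `ThetaSatDischarge` — NOTE the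
  extra hypothesis `hK` (ORDER CLAUSE (Θ-sat-≤), STATUS 13:11:45Z (4): the pulled-back level must be smaller in the
  PAIR order `Γ'.Γ ≤ Γ.Γ ∧ Γ'.K ≤ Γ.K`).
* `KTypeSituation.classSupplyDataOfSub` — `classSupplyDataAt` with the classical theta space replaced by ANY
  `Θ₀ ≤ weightForms Δ κ₁ τ₁` containing (as functions) the situation's restricted forms; `classSupplyDataSatAt` — the
  instance `Θ₀ := thetaSpaceSatOf … KΓ …` for a situation saturated at `KΓ` (feeds `SupplySituationAt.sat` in the
  re-staged `Model/ThetaClassInputInstance`).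
STATUS: UNCHECKED DRAFT (hub-load courtesy (TTTT′)(2): no private build before p-g11's RUN-35 GREEN line); the
successor theta-3-g9 compiles it with the PRIVATE BUILD RECIPE of `mc-theta-3-g8/HANDOFF.md` §5 and stages it as
row #S1 of the (Θ-sat) pin packet.
-/
import Summits.HodgeConjecture.HodgeCM.Model.ThetaSpace

/-!
# Saturated classical theta spaces (the (Θ-sat) pin leaf)

For pair data `P : WeilPairData K L J GU`, an archimedean restriction datum `(ιinf, Δ, κ₁, τ₁)` and a subgroup
`KΓ ≤ GU` (the compact open `K_f` of the arithmetic level, placed in `G_U(𝔸)`), the **saturated theta space**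
`thetaSpaceSatOf P ιinf Δ κ₁ τ₁ KΓ 𝓕` is the span of the restrictions `F ∘ ιinf` of the adelic theta forms of those
`K`-type situations `S` whose index group exhausts `KΓ` with trivial weight (`S.IsSaturated KΓ`).  Such forms are
right-`KΓ`-invariant, which is what the see-saw junction (J-Λ)/(J-sat) of the binder lane reads (BINDER-TRIAGE
§54, §56.2).  Everything here is abstract over `GU`; no `Level`, no `HermSpace3`.
-/

noncomputable section

open MeasureTheory NumberField NumberField.mixedEmbedding IsDedekindDomain
open Literature.NumberTheory.Automorphic Literature.NumberTheory.Weil1964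
open Literature.NumberTheory.Automorphic.WeightForms (ClassMapDatum thetaClasses restrictHom IsLevelCorrected
  IsWeightMatched)
open HodgeCM.PerL34.Seesaw HodgeCM.PerL34.RationalCoset HodgeCM.PerL34.SupplyAdelic
open HodgeCM.Model.SupplyInstance HodgeCM.Model.SupplyResidual
open HodgeCM.Model.SupplyResidual.WeilPairData (charInv)
open scoped Classical

namespace HodgeCM
namespace Model
namespace ThetaSpace

section Sat

variable {K L : Type} [Field K] [NumberField K] [Field L] [NumberField L] [Algebra K L] [FiniteDimensional K L]
variable {J : Type} [Fintype J] {GU : Type} [Group GU] [TopologicalSpace GU] [IsTopologicalGroup GU]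
  [LocallyCompactSpace GU]
variable {P : WeilPairData K L J GU} [CompactSpace (GU ⧸ P.ΓU)]
variable {G₁ K₁ W : Type} [Group G₁] [Group K₁] [AddCommGroup W] [Module ℂ W]
variable {ιinf : G₁ →* GU} {Δ : Subgroup G₁} {κ₁ : K₁ →* G₁} {τ₁ : Representation ℂ K₁ W}

/-! ### § 1. Saturated situations -/

/-- **A `K`-type situation is saturated at `KΓ ≤ G_U(𝔸)`** if every element of `KΓ` is the image of an index
element acting trivially on the weight: the adelic theta forms of the situation are then right-`KΓ`-invariant. -/
def KTypeSituation.IsSaturated (S : KTypeSituation P ιinf Δ κ₁ τ₁) (KΓ : Subgroup GU) : Prop :=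
  ∀ k ∈ KΓ, ∃ c : S.Kc, S.κ c = k ∧ S.τ c = 1

omit [CompactSpace (GU ⧸ P.ΓU)] in
/-- (Ported verbatim from the HodgeCMPerL package; no docstring in the source.) -/
theorem KTypeSituation.IsSaturated.anti {S : KTypeSituation P ιinf Δ κ₁ τ₁} {KΓ KΓ' : Subgroup GU}
    (hS : S.IsSaturated KΓ) (h : KΓ' ≤ KΓ) : S.IsSaturated KΓ' :=
  fun k hk => hS k (h hk)

omit [CompactSpace (GU ⧸ P.ΓU)] in
/-- Saturation at the trivial subgroup is no condition. -/
theorem KTypeSituation.isSaturated_bot (S : KTypeSituation P ιinf Δ κ₁ τ₁) : S.IsSaturated ⊥ :=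
  fun k hk => ⟨1, by rw [(Subgroup.mem_bot).1 hk, map_one], by rw [map_one]⟩

variable [Module.IsReflexive ℂ W]

omit [CompactSpace (GU ⧸ P.ΓU)] [Module.IsReflexive ℂ W] in
/-- Saturation is a condition on `(Kc, κ, τ)` only, so it survives reading the situation at a smaller level. -/
theorem KTypeSituation.IsSaturated.ofLE {S : KTypeSituation P ιinf Δ κ₁ τ₁} {KΓ : Subgroup GU}
    (hS : S.IsSaturated KΓ) {Δ' : Subgroup G₁} (h : Δ' ≤ Δ) : (S.ofLE h).IsSaturated KΓ :=
  hS

/-! ### § 1b. Strict situations ((SS-K) exit (X1), model1 14:09:46Z) -/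

/-- **A `K`-type situation is STRICT** if its test families intertwine `σ` with the Weil ACTION `s(κ c, 1)` ON THE
NOSE (the hypothesis of the tree's `ThetaKernelDatum.isThetaEquivariant_of_act`), not only as seen by the theta
distribution (`IsThetaEquivariant`).  The see-saw junction (binder-1's `SeesawHyp.wedge_mem`, tree
`GelbartRogawski1991/UnitaryDualPairSeesawWedgeKType.seesawWedge_mem_weightSpace`) needs the test vectors to be
`K`-type vectors on the nose, so the saturated theta space below ranges over strict situations only. -/
def KTypeSituation.IsStrict (S : KTypeSituation P ιinf Δ κ₁ τ₁) : Prop :=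
  ∀ j ∈ S.𝓙, ∀ (c : S.Kc) (e : S.E),
    j.1 (S.σ c e) = P.kernelDatum.W.act (P.kernelDatum.s (S.κ c, 1)) (j.1 e)

omit [CompactSpace (GU ⧸ P.ΓU)] [Module.IsReflexive ℂ W] in
/-- Strictness is a condition on `(Kc, κ, σ, 𝓙)` only, so it survives reading the situation at a smaller level. -/
theorem KTypeSituation.IsStrict.ofLE {S : KTypeSituation P ιinf Δ κ₁ τ₁} (hS : S.IsStrict) {Δ' : Subgroup G₁}
    (h : Δ' ≤ Δ) : (S.ofLE h).IsStrict :=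
  hS

omit [CompactSpace (GU ⧸ P.ΓU)] [Module.IsReflexive ℂ W] in
/-- **(E1)** In a strict situation the test vectors `φ^ℓ := j (ι ℓ)` transform under `κ(Kc) × 1` through `τ^∨`
ON THE NOSE: `s(κ c, 1) · φ^ℓ = φ^{τ^∨(c) ℓ}`. -/
theorem KTypeSituation.IsStrict.act_family {S : KTypeSituation P ιinf Δ κ₁ τ₁} (hS : S.IsStrict)
    {j : {j : S.E →ₗ[ℂ] P.weilDatum.ThetaTop // P.kernelDatum.IsThetaEquivariant S.κ S.σ j}} (hj : j ∈ S.𝓙)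
    (c : S.Kc) (ℓ : Module.Dual ℂ W) :
    P.kernelDatum.W.act (P.kernelDatum.s (S.κ c, 1)) (j.1 (S.ι ℓ)) = j.1 (S.ι (S.τ.dual c ℓ)) := by
  rw [S.hι c ℓ]
  exact (hS j hj c (S.ι ℓ)).symm

omit [CompactSpace (GU ⧸ P.ΓU)] [Module.IsReflexive ℂ W] in
/-- **(E2)** In a strict situation saturated at `KΓ`, the test vectors are `KΓ × 1`-FIXED on the nose. -/
theorem KTypeSituation.IsStrict.act_family_eq_self {S : KTypeSituation P ιinf Δ κ₁ τ₁} (hS : S.IsStrict)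
    {KΓ : Subgroup GU} (hsat : S.IsSaturated KΓ)
    {j : {j : S.E →ₗ[ℂ] P.weilDatum.ThetaTop // P.kernelDatum.IsThetaEquivariant S.κ S.σ j}} (hj : j ∈ S.𝓙)
    {k : GU} (hk : k ∈ KΓ) (ℓ : Module.Dual ℂ W) :
    P.kernelDatum.W.act (P.kernelDatum.s (k, 1)) (j.1 (S.ι ℓ)) = j.1 (S.ι ℓ) := by
  obtain ⟨c, rfl, hτ⟩ := hsat k hk
  have hinv : S.τ c⁻¹ = 1 := by
    calc S.τ c⁻¹ = S.τ c⁻¹ * S.τ c := by rw [hτ, mul_one]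
      _ = 1 := by rw [← map_mul, inv_mul_cancel, map_one]
  rw [hS.act_family hj c ℓ, Representation.dual_apply, hinv]
  have h1 : Module.Dual.transpose (R := ℂ) (1 : W →ₗ[ℂ] W) ℓ = ℓ := by
    ext w; simp [Module.Dual.transpose_apply]
  rw [h1]

omit [CompactSpace (GU ⧸ P.ΓU)] [Module.IsReflexive ℂ W] in
/-- **(E3)** In a strict situation the test vectors transform under the archimedean compact `K₁` (read in
`G_U(𝔸)` along `ιinf ∘ κ₁`) through `τ₁^∨` ON THE NOSE (weight matching `S.hη`). -/
theorem KTypeSituation.IsStrict.act_family_arch {S : KTypeSituation P ιinf Δ κ₁ τ₁} (hS : S.IsStrict)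
    {j : {j : S.E →ₗ[ℂ] P.weilDatum.ThetaTop // P.kernelDatum.IsThetaEquivariant S.κ S.σ j}} (hj : j ∈ S.𝓙)
    (u : K₁) (ℓ : Module.Dual ℂ W) :
    P.kernelDatum.W.act (P.kernelDatum.s (ιinf (κ₁ u), 1)) (j.1 (S.ι ℓ)) = j.1 (S.ι (τ₁.dual u ℓ)) := by
  rw [← S.hη.1 u, hS.act_family hj (S.η₁ u) ℓ, Representation.dual_apply, Representation.dual_apply, ← map_inv,
    S.hη.2 (u⁻¹)]

omit [CompactSpace (GU ⧸ P.ΓU)] in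
/-- In the model the Weil ACTION of the pair's theta-kernel datum is the representation `ω` (`s = id`, tree
`adelicOfDualPairRep_act`), hence multiplicative — the tree's abstract `ThetaKernelDatum` carries no `act_mul`
law, the pair datum `WeilPairData` does. -/
theorem _root_.HodgeCM.Model.SupplyResidual.WeilPairData.kernelDatum_act_mul
    (S₁ S₂ : GU × relNormOneIdeles K L) (Φ : P.weilDatum.ThetaTop) :
    P.kernelDatum.W.act (S₁ * S₂) Φ = P.kernelDatum.W.act S₁ (P.kernelDatum.W.act S₂ Φ) := by
  change P.ω (S₁ * S₂) Φ = P.ω S₁ (P.ω S₂ Φ)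
  rw [map_mul]
  rfl

omit [CompactSpace (GU ⧸ P.ΓU)] [Module.IsReflexive ℂ W] in
/-- **(E4)** (E2) × (E3): under `(ι₁-factor of K_∞) × KΓ` — in particular under the compact factors at the places
`b ≠ ι₁` (they lie in `KΓ ⊇ awayFromCM`) times the finite level — the test vectors of a strict situation saturated
at `KΓ` transform through `τ₁^∨` of the `ι₁`-component alone (binder-1's (x-Θ) `hA`/`hB`, index
`archIsotropy = (ι₁-factor) × ker π_τ`, STATUS 15:08:58Z / 15:09:56Z). -/
theorem KTypeSituation.IsStrict.act_family_arch_mul {S : KTypeSituation P ιinf Δ κ₁ τ₁} (hS : S.IsStrict)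
    {KΓ : Subgroup GU} (hsat : S.IsSaturated KΓ)
    {j : {j : S.E →ₗ[ℂ] P.weilDatum.ThetaTop // P.kernelDatum.IsThetaEquivariant S.κ S.σ j}} (hj : j ∈ S.𝓙)
    (u : K₁) {a : GU} (ha : a ∈ KΓ) (ℓ : Module.Dual ℂ W) :
    P.kernelDatum.W.act (P.kernelDatum.s (ιinf (κ₁ u) * a, 1)) (j.1 (S.ι ℓ)) = j.1 (S.ι (τ₁.dual u ℓ)) := by
  have hmul : ((ιinf (κ₁ u) * a, 1) : GU × relNormOneIdeles K L) = (ιinf (κ₁ u), 1) * (a, 1) := by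
    simp [Prod.mk_mul_mk]
  rw [hmul, map_mul, WeilPairData.kernelDatum_act_mul, hS.act_family_eq_self hsat hj ha ℓ,
    hS.act_family_arch hj u ℓ]

/-! ### § 2. The saturated theta space -/

variable (P ιinf Δ κ₁ τ₁) in
/-- **The `KΓ`-saturated classical theta space of the level**: the span of the archimedean restrictions of the
adelic theta forms (weight functions in `𝓕`) of all STRICT `K`-type situations saturated at `KΓ`. -/
def thetaSpaceSatOf (KΓ : Subgroup GU) (𝓕 : Set C(relNormOneIdeles K L ⧸ relNormOneRat K L, ℂ)) :
    Submodule ℂ (weightForms Δ κ₁ τ₁) :=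
  ⨆ S : {S : KTypeSituation P ιinf Δ κ₁ τ₁ // S.IsSaturated KΓ ∧ S.IsStrict}, S.1.forms 𝓕

variable {KΓ KΓ' : Subgroup GU} {𝓕 : Set C(relNormOneIdeles K L ⧸ relNormOneRat K L, ℂ)}

/-- **(E5)** the strict-saturated theta space lies in the supremum over ALL situations saturated at `KΓ`
(saturation spelled out; binder-1's `hΘ` of `Gen12Residual.ofSaturated`, `Model/Binders/Gen12RepOfSat.lean`,
STATUS 15:19:07Z): forget strictness. -/
theorem thetaSpaceSatOf_le_iSup_saturated (KΓ : Subgroup GU)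
    (𝓕 : Set C(relNormOneIdeles K L ⧸ relNormOneRat K L, ℂ)) :
    thetaSpaceSatOf P ιinf Δ κ₁ τ₁ KΓ 𝓕 ≤
      ⨆ S : {S : KTypeSituation P ιinf Δ κ₁ τ₁ // ∀ k ∈ KΓ, ∃ c : S.Kc, S.κ c = k ∧ S.τ c = 1}, S.1.forms 𝓕 :=
  iSup_le fun S => le_iSup_of_le ⟨S.1, S.2.1⟩ le_rfl

/-- (Ported verbatim from the HodgeCMPerL package; no docstring in the source.) -/
theorem forms_le_thetaSpaceSatOf (S : KTypeSituation P ιinf Δ κ₁ τ₁) (hS : S.IsSaturated KΓ) (hst : S.IsStrict)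
    (𝓕 : Set C(relNormOneIdeles K L ⧸ relNormOneRat K L, ℂ)) :
    S.forms 𝓕 ≤ thetaSpaceSatOf P ιinf Δ κ₁ τ₁ KΓ 𝓕 :=
  le_iSup (fun S' : {S : KTypeSituation P ιinf Δ κ₁ τ₁ // S.IsSaturated KΓ ∧ S.IsStrict} => S'.1.forms 𝓕)
    ⟨S, hS, hst⟩

/-- (Ported verbatim from the HodgeCMPerL package; no docstring in the source.) -/
theorem restrictHom_mem_thetaSpaceSatOf (S : KTypeSituation P ιinf Δ κ₁ τ₁) (hS : S.IsSaturated KΓ)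
    (hst : S.IsStrict) {F : weightForms P.ΓU S.κ S.τ} (hF : F ∈ S.thetaForms 𝓕) :
    restrictHom ιinf S.hΔ S.hη F ∈ thetaSpaceSatOf P ιinf Δ κ₁ τ₁ KΓ 𝓕 :=
  forms_le_thetaSpaceSatOf S hS hst 𝓕 (S.restrictHom_mem_forms hF)

/-- The saturated theta space is the smallest space containing every strict saturated situation's restricted
forms. -/
theorem thetaSpaceSatOf_le_iff {M : Submodule ℂ (weightForms Δ κ₁ τ₁)} :
    thetaSpaceSatOf P ιinf Δ κ₁ τ₁ KΓ 𝓕 ≤ M ↔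
      ∀ S : KTypeSituation P ιinf Δ κ₁ τ₁, S.IsSaturated KΓ → S.IsStrict → S.forms 𝓕 ≤ M :=
  iSup_le_iff.trans ⟨fun h S hsat hstr => h ⟨S, hsat, hstr⟩, fun h S => h S.1 S.2.1 S.2.2⟩

/-- Saturated theta forms are theta forms. -/
theorem thetaSpaceSatOf_le_thetaSpaceOf :
    thetaSpaceSatOf P ιinf Δ κ₁ τ₁ KΓ 𝓕 ≤ thetaSpaceOf P ιinf Δ κ₁ τ₁ 𝓕 :=
  thetaSpaceSatOf_le_iff.2 fun S _ _ => forms_le_thetaSpaceOf S 𝓕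

/-- **Antitonicity in the saturation index**: a deeper `KΓ' ≤ KΓ` saturates more situations. -/
theorem thetaSpaceSatOf_anti (h : KΓ' ≤ KΓ) :
    thetaSpaceSatOf P ιinf Δ κ₁ τ₁ KΓ 𝓕 ≤ thetaSpaceSatOf P ιinf Δ κ₁ τ₁ KΓ' 𝓕 :=
  thetaSpaceSatOf_le_iff.2 fun S hS hst => forms_le_thetaSpaceSatOf S (hS.anti h) hst 𝓕

/-- **v2 comparison**: saturation at `⊥` is the span of the STRICT situations' forms inside the unsaturated theta
space of `Model/ThetaSpace` (equality held before (X1); with strictness only `≤`, which is all any consumer uses). -/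
theorem thetaSpaceSatOf_bot_le :
    thetaSpaceSatOf P ιinf Δ κ₁ τ₁ ⊥ 𝓕 ≤ thetaSpaceOf P ιinf Δ κ₁ τ₁ 𝓕 :=
  thetaSpaceSatOf_le_thetaSpaceOf

/-- **LEVEL-CHANGE ENGINE (saturated)**: for `Δ' ≤ Δ` AND `KΓ' ≤ KΓ`, every element of the `KΓ`-saturated theta
space of level `Δ` is, as a function on `G₁`, an element of the `KΓ'`-saturated theta space of level `Δ'` (the same
adelic form, situation `S.ofLE h`, saturation inherited by `IsSaturated.anti`).  Replaces
`exists_mem_thetaSpaceOf_coe_eq_of_le` in `Model/ThetaSatDischarge` under (Θ-sat); the extra `hK` is the ORDER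
CLAUSE (Θ-sat-≤): the covering level must be smaller in the PAIR order. -/
theorem exists_mem_thetaSpaceSatOf_coe_eq_of_le {Δ' : Subgroup G₁} (h : Δ' ≤ Δ) (hK : KΓ' ≤ KΓ)
    (𝓕 : Set C(relNormOneIdeles K L ⧸ relNormOneRat K L, ℂ)) {F : weightForms Δ κ₁ τ₁}
    (hF : F ∈ thetaSpaceSatOf P ιinf Δ κ₁ τ₁ KΓ 𝓕) :
    ∃ F' ∈ thetaSpaceSatOf P ιinf Δ' κ₁ τ₁ KΓ' 𝓕, (F' : G₁ → W) = (F : G₁ → W) := by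
  induction hF using Submodule.iSup_induction' with
  | mem S F hF =>
    obtain ⟨F₀, hF₀, rfl⟩ := Submodule.mem_map.mp hF
    exact ⟨restrictHom ιinf (S.1.ofLE h).hΔ (S.1.ofLE h).hη F₀,
      restrictHom_mem_thetaSpaceSatOf (S.1.ofLE h) ((S.2.1.anti hK).ofLE h) (S.2.2.ofLE h) (𝓕 := 𝓕) hF₀, rfl⟩
  | zero => exact ⟨0, Submodule.zero_mem _, rfl⟩
  | add F₁ F₂ _ _ h₁ h₂ =>
    obtain ⟨F₁', h₁', e₁⟩ := h₁
    obtain ⟨F₂', h₂', e₂⟩ := h₂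
    exact ⟨F₁' + F₂', Submodule.add_mem _ h₁' h₂', by rw [Submodule.coe_add, Submodule.coe_add, e₁, e₂]⟩

/-! ### § 3. The junction and the class supply data, saturated -/

variable {H : Type*} [AddCommGroup H] [Module ℂ H]

/-- The theta classes of ONE saturated situation, read through the transported datum, lie in the theta classes of
the saturated theta space (`thetaClasses_situation_subset_thetaSpace` with `Θ₀ := thetaSpaceSatOf …`). -/
theorem thetaClasses_situation_subset_thetaSpaceSatOf (S : KTypeSituation P ιinf Δ κ₁ τ₁)
    (hS : S.IsSaturated KΓ) (hst : S.IsStrict) (𝓕 : Set C(relNormOneIdeles K L ⧸ relNormOneRat K L, ℂ))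
    {η₀ : K₁ →* K₁}
    {hΔ₀ : IsLevelCorrected Δ κ₁ τ₁ (MonoidHom.id G₁) Δ}
    {hη₀ : IsWeightMatched κ₁ τ₁ (MonoidHom.id G₁) κ₁ τ₁ η₀} (D₀ : ClassMapDatum (MonoidHom.id G₁) hΔ₀ hη₀ H) :
    thetaClasses ιinf (transportDatum (MonoidHom.id G₁) ιinf D₀ S.hΔ S.hη) (S.thetaForms 𝓕) ⊆
      thetaClasses (MonoidHom.id G₁) D₀ (thetaSpaceSatOf P ιinf Δ κ₁ τ₁ KΓ 𝓕) :=
  thetaClasses_situation_subset_thetaSpace S 𝓕 D₀ fun F hF => ⟨F, forms_le_thetaSpaceSatOf S hS hst 𝓕 hF, rfl⟩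

/-- **Class supply data at `φ_N` from a situation, against ANY classical space `Θ₀` of level `Δ`** containing
(as functions on `G₁`) the situation's restricted theta forms — `KTypeSituation.classSupplyDataAt` of
`Model/ThetaSpace` § 4 is the instance `Θ₀ := thetaSpaceOf …`, `classSupplyDataSatAt` below the instance
`Θ₀ := thetaSpaceSatOf …`. -/
def KTypeSituation.classSupplyDataOfSub (S : KTypeSituation P ιinf Δ κ₁ τ₁) {U : Universe} (T : U.ThetaModel)
    {Lc : CMField} {ι₁ : Lc →+* ℂ} (V : HermSpace3 Lc ι₁) (c : SeesawCtx Lc) (k : Fin 4) (N : ℕ)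
    (𝓕 : Set C(relNormOneIdeles K L ⧸ relNormOneRat K L, ℂ)) (Γ₀ : Level V) {η₀ : K₁ →* K₁}
    {hΔ₀ : IsLevelCorrected Δ κ₁ τ₁ (MonoidHom.id G₁) Δ} {hη₀ : IsWeightMatched κ₁ τ₁ (MonoidHom.id G₁) κ₁ τ₁ η₀}
    (D₀ : ClassMapDatum (MonoidHom.id G₁) hΔ₀ hη₀ (U.CohC (U.pms Lc ι₁ V Γ₀) 1))
    {Θ₀ : Submodule ℂ (weightForms Δ κ₁ τ₁)}
    (hΘ₀ : ∀ F ∈ S.forms 𝓕, ∃ F₀ ∈ Θ₀, (F₀ : G₁ → W) = (F : G₁ → W))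
    (hT : thetaClasses (MonoidHom.id G₁) D₀ Θ₀ ⊆ T.Theta V c k Γ₀)
    (fam : ∃ j ∈ S.𝓙, ∃ ℓ : Module.Dual ℂ W, j.1 (S.ι ℓ) = P.testFunT N)
    (char_mem : ∀ χ : PontryaginDual (relNormOneIdeles K L ⧸ relNormOneRat K L),
      (∀ t : relNormOneInfUnits K L,
        ((χ ((relNormOneInfToIdeles K L t : relNormOneIdeles K L) :
          relNormOneIdeles K L ⧸ relNormOneRat K L) : Circle) : ℂ) * P.w t = 1) → charInv χ ∈ 𝓕)
    (hol : ∀ j ∈ S.𝓙, ∀ f ∈ 𝓕, restrictHom ιinf S.hΔ S.hη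
      (P.kernelDatum.thetaForm (probHaarRelNormOneQuot K L) P.kernelDatum_thetaLinear S.κ j.1 j.2 S.ι S.hι f) ∈
        D₀.Hol) :
    P.ClassSupplyDataAt T V c k N where
  Kc := S.Kc
  κ := S.κ
  E := S.E
  σ := S.σ
  W := W
  τ := S.τ
  ι := S.ι
  hι := S.hι
  G₁ := G₁
  K₁ := K₁
  ιinf := ιinf
  Δ := Δ
  κ₁ := κ₁
  τ₁ := τ₁
  η₁ := S.η₁
  hΔ := S.hΔ
  hη := S.hη
  Γ₀ := Γ₀
  D := transportDatum (MonoidHom.id G₁) ιinf D₀ S.hΔ S.hη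
  𝓙 := S.𝓙
  𝓕 := 𝓕
  fam := fam
  char_mem := char_mem
  hol := hol
  theta_sub := (thetaClasses_situation_subset_thetaSpace S 𝓕 D₀ hΘ₀).trans hT

/-- **Class supply data at `φ_N` from a situation SATURATED at `KΓ`**, for any theta model whose `Θ_k(Γ₀)`
contains the theta classes of the `KΓ`-saturated classical theta space. -/
def KTypeSituation.classSupplyDataSatAt (S : KTypeSituation P ιinf Δ κ₁ τ₁) (hS : S.IsSaturated KΓ)
    (hst : S.IsStrict) {U : Universe} (T : U.ThetaModel) {Lc : CMField} {ι₁ : Lc →+* ℂ} (V : HermSpace3 Lc ι₁) (c : SeesawCtx Lc)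
    (k : Fin 4) (N : ℕ) (𝓕 : Set C(relNormOneIdeles K L ⧸ relNormOneRat K L, ℂ)) (Γ₀ : Level V) {η₀ : K₁ →* K₁}
    {hΔ₀ : IsLevelCorrected Δ κ₁ τ₁ (MonoidHom.id G₁) Δ} {hη₀ : IsWeightMatched κ₁ τ₁ (MonoidHom.id G₁) κ₁ τ₁ η₀}
    (D₀ : ClassMapDatum (MonoidHom.id G₁) hΔ₀ hη₀ (U.CohC (U.pms Lc ι₁ V Γ₀) 1))
    (hT : thetaClasses (MonoidHom.id G₁) D₀ (thetaSpaceSatOf P ιinf Δ κ₁ τ₁ KΓ 𝓕) ⊆ T.Theta V c k Γ₀)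
    (fam : ∃ j ∈ S.𝓙, ∃ ℓ : Module.Dual ℂ W, j.1 (S.ι ℓ) = P.testFunT N)
    (char_mem : ∀ χ : PontryaginDual (relNormOneIdeles K L ⧸ relNormOneRat K L),
      (∀ t : relNormOneInfUnits K L,
        ((χ ((relNormOneInfToIdeles K L t : relNormOneIdeles K L) :
          relNormOneIdeles K L ⧸ relNormOneRat K L) : Circle) : ℂ) * P.w t = 1) → charInv χ ∈ 𝓕)
    (hol : ∀ j ∈ S.𝓙, ∀ f ∈ 𝓕, restrictHom ιinf S.hΔ S.hη
      (P.kernelDatum.thetaForm (probHaarRelNormOneQuot K L) P.kernelDatum_thetaLinear S.κ j.1 j.2 S.ι S.hι f) ∈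
        D₀.Hol) :
    P.ClassSupplyDataAt T V c k N :=
  S.classSupplyDataOfSub T V c k N 𝓕 Γ₀ D₀ (fun F hF => ⟨F, forms_le_thetaSpaceSatOf S hS hst 𝓕 hF, rfl⟩) hT fam
    char_mem hol

end Sat

end ThetaSpace
end Model
end HodgeCM

end
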